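import Mathlib
import HarnessLib

/-!
# Line «spiral-closure» v2 (DSS-wall rung line on crux `TypeIQuarterGate.ScarEnvelopeTypeI`,
stmt-NavierStokesRegularity-23843) — obligation (S4) `ClosedMonoidDichotomy`, THE LEVER, landed

Author of the line and of these proofs: ns-idea-7 g4 (`Cruxes/ScarEnvelopeTypeI/Lines/spiral_closure.lean`
v2, commit 6da3311cc495, sha256/16 `af35dd6c732afbc1`; critic of record idea-crit-7 g2, PASS-WITH-PRICE
2026-08-28T11:50:40Z). Landed by ns-in-wu-con g2 (KEY DIRECTOR-NS #216 (1)(a) / #218 (3)) with the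
definition `ClosedMonoidDichotomy` and the proof block `natMul_mem … closedMonoidDichotomy_holds` copied
VERBATIM from the v2 workfile (only change: this header and the landing docstring notes).

**Rigidity of closed forward monoids.** A closed `M ⊆ [0,∞) × ℝ`, additively closed with `0 ∈ M`,
stable under `(0,θ) ↦ (0,−θ)`, containing `(0,2π)` and points with arbitrarily small positive first
coordinate, contains ALL of `[0,∞) × ℝ` or a RAY `{(σ, βσ) : σ ≥ 0}` (elementary; closed subgroups of
`ℝ²` à la Bourbaki TG VII §1, adapted to forward monoids).

No statement about Navier–Stokes is proved here; this is the pure lever of a rung line that does NOT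
conclude stmt-23843 (its output is the kernel equivalence `UniformNearOneRdss C₀ ↔ RssLiouvilleAll C₀`
CONDITIONAL on the two remaining stubs S2/S6).
-/

-- landing convention of this crux's line files (namespace of the line «spiral-closure»)
set_option linter.dupNamespace false

noncomputable section

namespace Summit.NavierStokesRegularity.NavierStokesRegularity.Cruxes.ScarEnvelopeTypeI.SpiralClosure

open MeasureTheory Set Function Filter Topology Metric

/-- (S4) **THE LEVER — rigidity of closed forward monoids.**  A closed subset `M ⊆ [0,∞) × ℝ`, additively
closed with `0 ∈ M`, stable under `(0,θ) ↦ (0,−θ)`, containing `(0,2π)` and points with arbitrarily small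
POSITIVE first coordinate, contains either ALL of `[0,∞) × ℝ` or a RAY `{(σ, βσ) : σ ≥ 0}`.
(Proof: reduce the small elements' angles into `[−π,π]` using `(0,±2π)`; a convergent subsequence tends to
`(0,θ*) ∈ M`; subtracting `(0,θ*)` gives `h_k ∈ M`, `h_k → 0`, `h_k ≠ 0`; `⌊τ/‖h_k‖⌋ h_k → τ w` puts the ray
`ℝ₊ w` in `M`, `w = lim h_k/‖h_k‖`, `w₁ ≥ 0`; `w₁ > 0` is the ray case with `β = w₂/w₁`; `w₁ = 0` gives
`{0} × ℝ ⊆ M`, and then `(nσ_k, θ) ∈ M` for the small elements `(σ_k, θ_k)` fills `[0,∞) × ℝ` by closedness.) -/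
def ClosedMonoidDichotomy : Prop :=
  ∀ M : Set (ℝ × ℝ), IsClosed M → (∀ g ∈ M, 0 ≤ g.1) → ((0 : ℝ), (0 : ℝ)) ∈ M →
    (∀ g ∈ M, ∀ h ∈ M, g + h ∈ M) →
    (∀ θ : ℝ, ((0 : ℝ), θ) ∈ M → ((0 : ℝ), -θ) ∈ M) →
    ((0 : ℝ), 2 * Real.pi) ∈ M →
    (∀ ε : ℝ, 0 < ε → ∃ g ∈ M, 0 < g.1 ∧ g.1 < ε) →
    (∀ σ θ : ℝ, 0 ≤ σ → (σ, θ) ∈ M) ∨ (∃ β : ℝ, ∀ σ : ℝ, 0 ≤ σ → (σ, β * σ) ∈ M)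


/-! ### (S4) proved (v2): the lever -/

/-- Real multiples `n • g` of an element stay in an additive monoid. -/
theorem natMul_mem {M : Set (ℝ × ℝ)} (h0 : ((0 : ℝ), (0 : ℝ)) ∈ M)
    (hadd : ∀ g ∈ M, ∀ h ∈ M, g + h ∈ M) {g : ℝ × ℝ} (hg : g ∈ M) :
    ∀ n : ℕ, (n : ℝ) • g ∈ M := by
  intro n
  induction n with
  | zero =>
      have e : ((0 : ℕ) : ℝ) • g = ((0 : ℝ), (0 : ℝ)) := Prod.ext (by simp) (by simp)
      rw [e]; exact h0
  | succ n ih =>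
      have e : ((n : ℝ) + 1) • g = (n : ℝ) • g + g := by rw [add_smul, one_smul]
      rw [Nat.cast_succ, e]
      exact hadd _ ih _ hg

/-- Integer multiples of the full turn are in `M`. -/
theorem rotInt_mem {M : Set (ℝ × ℝ)} (h0 : ((0 : ℝ), (0 : ℝ)) ∈ M)
    (hadd : ∀ g ∈ M, ∀ h ∈ M, g + h ∈ M)
    (hneg : ∀ θ : ℝ, ((0 : ℝ), θ) ∈ M → ((0 : ℝ), -θ) ∈ M)
    (h2pi : ((0 : ℝ), 2 * Real.pi) ∈ M) (z : ℤ) : ((0 : ℝ), 2 * Real.pi * z) ∈ M := by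
  obtain ⟨n, rfl | rfl⟩ := z.eq_nat_or_neg
  · have h := natMul_mem h0 hadd h2pi n
    have e : (n : ℝ) • ((0 : ℝ), 2 * Real.pi) = ((0 : ℝ), 2 * Real.pi * ((n : ℤ) : ℝ)) :=
      Prod.ext (by simp) (by simp; ring)
    rwa [e] at h
  · have h := natMul_mem h0 hadd (hneg _ h2pi) n
    have e : (n : ℝ) • ((0 : ℝ), -(2 * Real.pi)) = ((0 : ℝ), 2 * Real.pi * ((-(n : ℤ) : ℤ) : ℝ)) :=
      Prod.ext (by simp) (by simp; ring)
    rwa [e] at h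

/-- Angle reduction: every element has a representative with the same scaling and angle in `[0, 2π]`. -/
theorem angle_reduce {M : Set (ℝ × ℝ)} (h0 : ((0 : ℝ), (0 : ℝ)) ∈ M)
    (hadd : ∀ g ∈ M, ∀ h ∈ M, g + h ∈ M)
    (hneg : ∀ θ : ℝ, ((0 : ℝ), θ) ∈ M → ((0 : ℝ), -θ) ∈ M)
    (h2pi : ((0 : ℝ), 2 * Real.pi) ∈ M) {g : ℝ × ℝ} (hg : g ∈ M) :
    ∃ θ ∈ Icc (0 : ℝ) (2 * Real.pi), (g.1, θ) ∈ M := by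
  have h2 : (0 : ℝ) < 2 * Real.pi := by positivity
  set k : ℤ := ⌊g.2 / (2 * Real.pi)⌋ with hk
  refine ⟨g.2 - 2 * Real.pi * k, ⟨?_, ?_⟩, ?_⟩
  · have h := Int.floor_le (g.2 / (2 * Real.pi))
    rw [← hk, le_div_iff₀ h2] at h
    linarith
  · have h := Int.lt_floor_add_one (g.2 / (2 * Real.pi))
    rw [← hk, div_lt_iff₀ h2] at h
    have e : ((k : ℝ) + 1) * (2 * Real.pi) = 2 * Real.pi * k + 2 * Real.pi := by ring
    linarith
  · have hrot := rotInt_mem h0 hadd hneg h2pi (-k)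
    have h := hadd g hg _ hrot
    have e : g + ((0 : ℝ), 2 * Real.pi * ((-k : ℤ) : ℝ)) = (g.1, g.2 - 2 * Real.pi * k) :=
      Prod.ext (by simp) (by simp; ring)
    rwa [e] at h

/-- Squeeze: `⌊τ / a_k⌋ a_k → τ` when `a_k → 0⁺`. -/
theorem floor_mul_tendsto {a : ℕ → ℝ} {τ : ℝ} (hτ : 0 ≤ τ) (hpos : ∀ k, 0 < a k)
    (hlim : Tendsto a atTop (𝓝 0)) :
    Tendsto (fun k => (⌊τ / a k⌋₊ : ℝ) * a k) atTop (𝓝 τ) := by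
  have hlow : Tendsto (fun k => τ - a k) atTop (𝓝 τ) := by
    simpa using tendsto_const_nhds.sub hlim
  refine tendsto_of_tendsto_of_tendsto_of_le_of_le hlow tendsto_const_nhds (fun k => ?_) (fun k => ?_)
  · have h := Nat.lt_floor_add_one (τ / a k)
    rw [div_lt_iff₀ (hpos k)] at h
    have e : ((⌊τ / a k⌋₊ : ℝ) + 1) * a k = (⌊τ / a k⌋₊ : ℝ) * a k + a k := by ring
    show τ - a k ≤ (⌊τ / a k⌋₊ : ℝ) * a k
    linarith
  · have h := Nat.floor_le (div_nonneg hτ (hpos k).le)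
    show (⌊τ / a k⌋₊ : ℝ) * a k ≤ τ
    rwa [le_div_iff₀ (hpos k)] at h

/-- If all pure rotations lie in `M` and `M` has arbitrarily small positive scalings, `M` is everything. -/
theorem fill_of_rotations {M : Set (ℝ × ℝ)} (hcl : IsClosed M) (h0 : ((0 : ℝ), (0 : ℝ)) ∈ M)
    (hadd : ∀ g ∈ M, ∀ h ∈ M, g + h ∈ M)
    (hsmall : ∀ ε : ℝ, 0 < ε → ∃ g ∈ M, 0 < g.1 ∧ g.1 < ε)
    (hrot : ∀ θ : ℝ, ((0 : ℝ), θ) ∈ M) : ∀ σ θ : ℝ, 0 ≤ σ → (σ, θ) ∈ M := by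
  intro σ θ hσ
  choose g hgM hgpos hglt using fun k : ℕ => hsmall (1 / ((k : ℝ) + 1)) (by positivity)
  have hg0 : Tendsto (fun k => (g k).1) atTop (𝓝 0) :=
    tendsto_of_tendsto_of_tendsto_of_le_of_le tendsto_const_nhds
      tendsto_one_div_add_atTop_nhds_zero_nat (fun k => (hgpos k).le) fun k => (hglt k).le
  have hmem : ∀ k, ((⌊σ / (g k).1⌋₊ : ℝ) * (g k).1, θ) ∈ M := by
    intro k
    have h1 := natMul_mem h0 hadd (hgM k) ⌊σ / (g k).1⌋₊
    have h2 := hrot (θ - (⌊σ / (g k).1⌋₊ : ℝ) * (g k).2)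
    have h := hadd _ h1 _ h2
    have e : (⌊σ / (g k).1⌋₊ : ℝ) • g k + ((0 : ℝ), θ - (⌊σ / (g k).1⌋₊ : ℝ) * (g k).2) =
        ((⌊σ / (g k).1⌋₊ : ℝ) * (g k).1, θ) := Prod.ext (by simp) (by simp)
    rwa [e] at h
  have hconv : Tendsto (fun k => ((⌊σ / (g k).1⌋₊ : ℝ) * (g k).1, θ)) atTop (𝓝 (σ, θ)) :=
    (floor_mul_tendsto hσ hgpos hg0).prodMk_nhds tendsto_const_nhds
  exact hcl.mem_of_tendsto hconv (Eventually.of_forall hmem)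

/-- **THE LEVER, PROVED (v2; was stub S4).** Rigidity of closed forward monoids in `[0,∞) × ℝ`. -/
theorem closedMonoidDichotomy_of (M : Set (ℝ × ℝ)) (hcl : IsClosed M) (hnn : ∀ g ∈ M, 0 ≤ g.1)
    (h0 : ((0 : ℝ), (0 : ℝ)) ∈ M) (hadd : ∀ g ∈ M, ∀ h ∈ M, g + h ∈ M)
    (hneg : ∀ θ : ℝ, ((0 : ℝ), θ) ∈ M → ((0 : ℝ), -θ) ∈ M) (h2pi : ((0 : ℝ), 2 * Real.pi) ∈ M)
    (hsmall : ∀ ε : ℝ, 0 < ε → ∃ g ∈ M, 0 < g.1 ∧ g.1 < ε) :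
    (∀ σ θ : ℝ, 0 ≤ σ → (σ, θ) ∈ M) ∨ (∃ β : ℝ, ∀ σ : ℝ, 0 ≤ σ → (σ, β * σ) ∈ M) := by
  have _ := hnn
  -- small elements with reduced angles
  choose g hgM hgpos hglt using fun k : ℕ => hsmall (1 / ((k : ℝ) + 1)) (by positivity)
  have hg0 : Tendsto (fun k => (g k).1) atTop (𝓝 0) :=
    tendsto_of_tendsto_of_tendsto_of_le_of_le tendsto_const_nhds
      tendsto_one_div_add_atTop_nhds_zero_nat (fun k => (hgpos k).le) fun k => (hglt k).le
  choose θr hθr hθM using fun k => angle_reduce h0 hadd hneg h2pi (hgM k)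
  set x : ℕ → ℝ × ℝ := fun k => ((g k).1, θr k) with hx
  have hxbd : ∀ k, x k ∈ closedBall (0 : ℝ × ℝ) (1 + 2 * Real.pi) := by
    intro k
    rw [mem_closedBall_zero_iff, Prod.norm_def]
    refine max_le ?_ ?_
    · rw [Real.norm_eq_abs, abs_of_pos (hgpos k)]
      have : (g k).1 < 1 := (hglt k).trans_le (by
        rw [div_le_one (by positivity)]; linarith [(Nat.cast_nonneg k : (0:ℝ) ≤ k)])
      linarith [Real.pi_pos]
    · rw [Real.norm_eq_abs, abs_of_nonneg (hθr k).1]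
      linarith [(hθr k).2]
  obtain ⟨a, -, φ, hφ, hlim⟩ := tendsto_subseq_of_bounded isBounded_closedBall hxbd
  have haM : a ∈ M := hcl.mem_of_tendsto hlim (Eventually.of_forall fun k => hθM (φ k))
  have ha1 : a.1 = 0 := by
    have h1 : Tendsto (fun k => (x (φ k)).1) atTop (𝓝 a.1) := (continuous_fst.tendsto a).comp hlim
    have h2 : Tendsto (fun k => (x (φ k)).1) atTop (𝓝 0) := hg0.comp hφ.tendsto_atTop
    exact tendsto_nhds_unique h1 h2
  have hnegA : ((0 : ℝ), -a.2) ∈ M := by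
    refine hneg _ ?_
    have e : ((0 : ℝ), a.2) = a := Prod.ext (by simp [ha1]) rfl
    rwa [e]
  -- nonzero elements tending to zero
  set h : ℕ → ℝ × ℝ := fun k => x (φ k) + ((0 : ℝ), -a.2) with hh
  have hhM : ∀ k, h k ∈ M := fun k => hadd _ (hθM (φ k)) _ hnegA
  have hhpos : ∀ k, 0 < (h k).1 := fun k => by
    simp only [hh, hx, Prod.fst_add, add_zero]
    exact hgpos _
  have hhlim : Tendsto h atTop (𝓝 0) := by
    have e : a + ((0 : ℝ), -a.2) = 0 := Prod.ext (by simp [ha1]) (by simp)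
    have := hlim.add (tendsto_const_nhds (x := ((0 : ℝ), -a.2)))
    rwa [e] at this
  have hnorm_pos : ∀ k, 0 < ‖h k‖ := fun k => by
    refine norm_pos_iff.2 fun hk => ?_
    have := hhpos k
    rw [hk] at this
    simp at this
  have hnormlim : Tendsto (fun k => ‖h k‖) atTop (𝓝 0) := by
    simpa using hhlim.norm
  -- directions
  set u : ℕ → ℝ × ℝ := fun k => ‖h k‖⁻¹ • h k with hu
  have hu1 : ∀ k, ‖u k‖ = 1 := fun k => by
    rw [hu, norm_smul, norm_inv, norm_norm, inv_mul_cancel₀ (hnorm_pos k).ne']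
  have hubd : ∀ k, u k ∈ closedBall (0 : ℝ × ℝ) 1 := fun k =>
    mem_closedBall_zero_iff.2 (hu1 k).le
  obtain ⟨w, -, ψ, hψ, hwlim⟩ := tendsto_subseq_of_bounded isBounded_closedBall hubd
  have hw1 : ‖w‖ = 1 := by
    have h1 : Tendsto (fun k => ‖u (ψ k)‖) atTop (𝓝 ‖w‖) := (continuous_norm.tendsto w).comp hwlim
    have h2 : Tendsto (fun k => ‖u (ψ k)‖) atTop (𝓝 1) := by
      simp only [hu1]; exact tendsto_const_nhds
    exact tendsto_nhds_unique h1 h2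
  have hwnn : 0 ≤ w.1 := by
    have hk : ∀ k, 0 ≤ (u (ψ k)).1 := fun k => by
      simp only [hu, Prod.smul_fst, smul_eq_mul]
      exact mul_nonneg (inv_nonneg.2 (norm_nonneg _)) (hhpos _).le
    exact isClosed_Ici.mem_of_tendsto ((continuous_fst.tendsto w).comp hwlim) (Eventually.of_forall hk)
  -- the ray `ℝ₊ w ⊆ M`
  have hray : ∀ τ : ℝ, 0 ≤ τ → τ • w ∈ M := by
    intro τ hτ
    have hmemk : ∀ k, ((⌊τ / ‖h (ψ k)‖⌋₊ : ℝ) * ‖h (ψ k)‖) • u (ψ k) ∈ M := by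
      intro k
      have hm := natMul_mem h0 hadd (hhM (ψ k)) ⌊τ / ‖h (ψ k)‖⌋₊
      have e : ((⌊τ / ‖h (ψ k)‖⌋₊ : ℝ) * ‖h (ψ k)‖) • u (ψ k) = (⌊τ / ‖h (ψ k)‖⌋₊ : ℝ) • h (ψ k) := by
        rw [hu, smul_smul, mul_assoc, mul_inv_cancel₀ (hnorm_pos _).ne', mul_one]
      rwa [e]
    have hcoef : Tendsto (fun k => (⌊τ / ‖h (ψ k)‖⌋₊ : ℝ) * ‖h (ψ k)‖) atTop (𝓝 τ) :=
      floor_mul_tendsto hτ (fun k => hnorm_pos (ψ k)) (hnormlim.comp hψ.tendsto_atTop)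
    exact hcl.mem_of_tendsto (hcoef.smul hwlim) (Eventually.of_forall hmemk)
  rcases hwnn.lt_or_eq with hpos | hzero
  · -- a genuine spiral/scaling ray
    right
    refine ⟨w.2 / w.1, fun σ hσ => ?_⟩
    have hm := hray (σ / w.1) (div_nonneg hσ hpos.le)
    have e : (σ / w.1) • w = (σ, w.2 / w.1 * σ) :=
      Prod.ext (by rw [Prod.smul_fst, smul_eq_mul, div_mul_cancel₀ _ hpos.ne'])
        (by rw [Prod.smul_snd, smul_eq_mul]; ring)
    rwa [e] at hm
  · -- all rotations, then fill
    left
    have hw2 : w.2 * w.2 = 1 := by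
      have hn := hw1
      rw [Prod.norm_def, Real.norm_eq_abs, Real.norm_eq_abs, ← hzero, abs_zero,
        max_eq_right (abs_nonneg _)] at hn
      nlinarith [abs_mul_abs_self w.2]
    have hrot : ∀ θ : ℝ, ((0 : ℝ), θ) ∈ M := by
      intro θ
      rcases le_or_gt 0 (θ * w.2) with hc | hc
      · have hm := hray (θ * w.2) hc
        have e : (θ * w.2) • w = ((0 : ℝ), θ) :=
          Prod.ext (by simp [← hzero]) (by simp; rw [mul_assoc, hw2, mul_one])
        rwa [e] at hm
      · have hm := hray (-(θ * w.2)) (by linarith)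
        have e : (-(θ * w.2)) • w = ((0 : ℝ), -θ) :=
          Prod.ext (by simp [← hzero]) (by simp; rw [mul_assoc, hw2, mul_one])
        rw [e] at hm
        simpa using hneg _ hm
    exact fill_of_rotations hcl h0 hadd hsmall hrot


/-- The lever in the registered form. -/
theorem closedMonoidDichotomy_holds : ClosedMonoidDichotomy := closedMonoidDichotomy_of

end Summit.NavierStokesRegularity.NavierStokesRegularity.Cruxes.ScarEnvelopeTypeI.SpiralClosure

end
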